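import Summits.CriticalPhenomena.PercolationContinuityZ3.Theorems.PercNearOneGluingNoHeavyLowerTailThreePointIsoAsymUniversal
import HarnessLib

/-!
# Generalised face inequalities `q·P(ac|b) + p·P(bc|a) ≥ P(a≁b)·P(c↔{a,b})` on every finite weighted graph; CONJECTURE AF¹ proved

Support file for crux `stmt-CriticalPhenomena-4575` (`NoHeavyLowerTail`), seat `prim-l12-p1` gen 34 (`--supports stmt-CriticalPhenomena-4575`);
memo `run/shared/lean/prim/prim-l12/FROM-prim-l12-p1-g34-LV-CONE-ASYM-ISOLATION.md`.  No definitions, no sorries, standard axioms; unconditional.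

From the asymmetric isolation laws `Q^{p+q} ≤ I_a^p I_b^q I_c` (`…ThreePointIsoAsymUniversal`, all `p, q ≥ 1` with `p² + pq + q² ≤ pq(p+q)`)
we derive their FACE (conditional) form.  Cells of the 3-point law at the port `c`: `t = P(ac|b) = I_b − Q`, `u = P(bc|a) = I_a − Q`,
`N₀ = P(a ≁ b) = I_a + I_b − Q`, `k = P(c ↔ {a,b}) = 1 − I_c`.

* `face_of_law` (pointwise): the law at `(Q, I_a, I_b, I_c)` implies `q·t + p·u ≥ N₀·k`.  PROOF: the law is inherited by every PENDANT
  extension of the port (new port `c'` joined to `c` by an edge of probability `w`; coordinates `N₀ − w(t+u)`, `N₀ − wt`, `N₀ − wu`, `1 − wk`) —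
  this is `ThreePointIsoAsymOnePair.asym_onePair_log` along the pendant edge, whose termwise inequalities are equalities — and the derivative
  at `w = 0` of the (nonnegative, vanishing at `0`) logarithmic slack is `(q·t + p·u)/N₀ − k`.
* `faceAsym_graph`: **for every finite weighted graph and all admissible `p, q`: `q·P(ac|b) + p·P(bc|a) ≥ P(a≁b)·P(c↔{a,b})`.**
  (`p = q = 3/2` is the face inequality `(C½)` `ThreePointFaceHalfAllGraphs.faceHalf_graph`; in the parametrisation `q = σp`:
  `u + σt ≥ c(σ)·N₀k`, `c(σ) = σ(1+σ)/(1+σ+σ²)`.)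
* `afOne_graph`: **CONJECTURE AF¹ of prim-l12-p1 gen 33 (memo `FROM-prim-l12-p1-g33-PORT-PART-SHARP-ROW.md` §10) is a THEOREM**: for every
  finite weighted graph, every port `c`, terminals `a, b`, and every `γ ∈ [0, 1]` (indeed every `γ ≥ 0`), both pendant quadratics
  `(¾t+¼u) + γ[(3/2)t + u − (3/2)N₀k] + γ²u ≥ 0` and its `t ↔ u` mirror hold — the member `σ = 3/(1+2γ)` of `faceAsym_graph` with the exact identity
  `4(2+γ)(1+2γ)·AF¹_τ = 6(1−γ)²·t + 2(1−γ)²(1+2γ)·u + γ·D̃`, `D̃ ≥ 0` the cleared face inequality.  Equivalently (envelope over `γ`):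
  `P(a≁b)·P(c↔{a,b}) ≤ m + (2/3)M + (2/3)√(M²+3mM)`, `m ≤ M` the one-sided attachments.  With `…SuperTerminalP3LamAFreePendant.crit_of_afOne` and
  `…SuperTerminalP3LamPortPiecesFour` (prim-l12-p1 gen 33) this discharges the `a`-free / `s`-free gluing criterion at `λ = 3/2`: a minimal
  counterexample to the sharp row `P3_{3/2}` is a union of `{s,a,b,c}`-pieces each touching ALL FOUR terminals.
-/

namespace Summit.CriticalPhenomena.PercolationContinuityZ3.Theorems.ThreePointIsoAsymFace

open MeasureTheory Set Filter Topology Real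
open Literature.Probability.Percolation Literature.Probability.LatticeModels
open Summit.CriticalPhenomena.PercolationContinuityZ3.Theorems.ThreePointIsoAsymOnePair
open Summit.CriticalPhenomena.PercolationContinuityZ3.Theorems.ThreePointIsoAsymUniversal
open scoped Classical

/-! ## The pointwise step: pendant inheritance and the derivative at the isolated port -/

section Law

/-- **Pendant inheritance (pointwise).**  If the logarithmic law holds at `(Q, I_a, I_b, I_c)` (with the order relations of a 3-point law),
it holds at the pendant coordinates `(N₀ − w(t+u), N₀ − wt, N₀ − wu, 1 − wk)` for every `w ∈ [0,1]`. [this work] -/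
theorem law_pendant {p q Q IA IB IC w : ℝ} (hp : 1 ≤ p) (hq : 1 ≤ q) (hpq : p ^ 2 + p * q + q ^ 2 ≤ p * q * (p + q))
    (hQ0 : 0 ≤ Q) (hQA : Q ≤ IA) (hQB : Q ≤ IB) (hQC : Q ≤ IC) (hN1 : IA + IB - Q ≤ 1)
    (hlaw : Q = 0 ∨ (p + q) * log Q ≤ p * log IA + q * log IB + log IC) (hw0 : 0 ≤ w) (hw1 : w ≤ 1) :
    (1 - w) * (IA + IB - Q) + w * Q = 0 ∨
      (p + q) * log ((1 - w) * (IA + IB - Q) + w * Q) ≤ p * log ((1 - w) * (IA + IB - Q) + w * IA) +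
        q * log ((1 - w) * (IA + IB - Q) + w * IB) + log ((1 - w) * 1 + w * IC) := by
  have h0 : IA + IB - Q = 0 ∨ (p + q) * log (IA + IB - Q) ≤ p * log (IA + IB - Q) + q * log (IA + IB - Q) + log 1 := by
    right; rw [log_one]; linarith
  exact asym_onePair_log (dqa := IB - Q) (dqb := IA - Q) hp hq hpq hQ0 (sub_nonneg.2 hQB) (sub_nonneg.2 hQA) (by ring)
    (by linarith) (by linarith) (hQ0.trans hQC) le_rfl le_rfl hN1 hQA hQB hQC (le_of_eq (by ring)) (le_of_eq (by ring)) h0 hlaw hw0 hw1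

/-- **The face inequality from the law (pointwise).**  If the logarithmic law `Q = 0 ∨ (p+q) log Q ≤ p log I_a + q log I_b + log I_c` holds at a
point with `0 ≤ Q ≤ I_a, I_b, I_c`, `I_c ≤ 1`, `I_a + I_b − Q ≤ 1`, then `q(I_b − Q) + p(I_a − Q) ≥ (I_a + I_b − Q)(1 − I_c)`. [this work] -/
theorem face_of_law {p q Q IA IB IC : ℝ} (hp : 1 ≤ p) (hq : 1 ≤ q) (hpq : p ^ 2 + p * q + q ^ 2 ≤ p * q * (p + q))
    (hQ0 : 0 ≤ Q) (hQA : Q ≤ IA) (hQB : Q ≤ IB) (hQC : Q ≤ IC) (hIC1 : IC ≤ 1) (hN1 : IA + IB - Q ≤ 1)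
    (hlaw : Q = 0 ∨ (p + q) * log Q ≤ p * log IA + q * log IB + log IC) :
    (IA + IB - Q) * (1 - IC) ≤ q * (IB - Q) + p * (IA - Q) := by
  set N := IA + IB - Q with hN
  set t := IB - Q with ht
  set u := IA - Q with hu
  set k := 1 - IC with hk
  have ht0 : 0 ≤ t := sub_nonneg.2 hQB
  have hu0 : 0 ≤ u := sub_nonneg.2 hQA
  have hk0 : 0 ≤ k := sub_nonneg.2 hIC1
  have hN0 : 0 ≤ N := by rw [hN]; linarith
  rcases hN0.eq_or_lt with hNz | hNp
  · rw [← hNz, zero_mul]; positivity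
  -- the logarithmic slack of the pendant extension, as a function of the pendant weight `w`
  set G : ℝ → ℝ := fun w => -((p + q) * log (N - w * (t + u)) - p * log (N - w * t) - q * log (N - w * u)) + log (1 - w * k)
    with hGdef
  have hG0 : G 0 = 0 := by simp [hGdef]; ring
  have hGpos : ∀ w ∈ Ioo (0 : ℝ) 1, 0 ≤ G w := by
    intro w hw
    have hw0 : 0 ≤ w := hw.1.le
    have hQw : 0 < (1 - w) * (IA + IB - Q) + w * Q := by
      have : 0 < (1 - w) * (IA + IB - Q) := mul_pos (by linarith [hw.2]) hNp
      nlinarith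
    rcases law_pendant hp hq hpq hQ0 hQA hQB hQC hN1 hlaw hw0 hw.2.le with hz | hlog
    · exact absurd hz hQw.ne'
    have e1 : (1 - w) * (IA + IB - Q) + w * Q = N - w * (t + u) := by rw [hN, ht, hu]; ring
    have e2 : (1 - w) * (IA + IB - Q) + w * IA = N - w * t := by rw [hN, ht]; ring
    have e3 : (1 - w) * (IA + IB - Q) + w * IB = N - w * u := by rw [hN, hu]; ring
    have e4 : (1 - w) * 1 + w * IC = 1 - w * k := by rw [hk]; ring
    rw [e1, e2, e3, e4] at hlog
    simp only [hGdef]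
    linarith
  -- derivative at `w = 0`
  have hNne : N - 0 * (t + u) ≠ 0 := by simpa using hNp.ne'
  have hNne' : N - 0 * t ≠ 0 := by simpa using hNp.ne'
  have hNne'' : N - 0 * u ≠ 0 := by simpa using hNp.ne'
  have hψ := hasDerivAt_psi (P := p + q) (p := p) (q := q) (q₀ := N) (dq := t + u) (a₀ := N) (da := t) (b₀ := N) (db := u)
    (r := 0) hNne hNne' hNne''
  have hL : HasDerivAt (fun w : ℝ => log (1 - w * k)) (-k / (1 - 0 * k)) 0 :=
    ((hasDerivAt_mul_const k).const_sub 1).log (by simp)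
  have hG : HasDerivAt G (-((p + q) * (-(t + u) / (N - 0 * (t + u))) - p * (-t / (N - 0 * t)) - q * (-u / (N - 0 * u)))
      + -k / (1 - 0 * k)) 0 := hψ.neg.add hL
  have eder : -((p + q) * (-(t + u) / (N - 0 * (t + u))) - p * (-t / (N - 0 * t)) - q * (-u / (N - 0 * u))) + -k / (1 - 0 * k) =
      (q * t + p * u) / N - k := by
    have hN0' : N ≠ 0 := hNp.ne'
    simp only [zero_mul, sub_zero, div_one]
    field_simp
    ring
  rw [eder] at hG
  -- the slope from the right is nonnegative, hence so is the derivative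
  have hslope : Tendsto (slope G 0) (𝓝[>] 0) (𝓝 ((q * t + p * u) / N - k)) := by
    have h := (hG.hasDerivWithinAt (s := Ioi 0))
    have hs : Ioi (0 : ℝ) \ {0} = Ioi 0 := by
      ext x; simp only [Set.mem_sdiff, mem_Ioi, mem_singleton_iff]; exact ⟨fun h => h.1, fun h => ⟨h, h.ne'⟩⟩
    rw [hasDerivWithinAt_iff_tendsto_slope, hs] at h
    exact h
  have hev : ∀ᶠ w in 𝓝[>] (0 : ℝ), 0 ≤ slope G 0 w := by
    filter_upwards [Ioo_mem_nhdsGT (zero_lt_one' ℝ)] with w hw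
    rw [slope_def_field, hG0, sub_zero, sub_zero]
    exact div_nonneg (hGpos w hw) hw.1.le
  have hder : 0 ≤ (q * t + p * u) / N - k := ge_of_tendsto hslope hev
  have : k ≤ (q * t + p * u) / N := by linarith
  rw [le_div_iff₀ hNp] at this
  linarith

end Law

/-! ## The face inequalities on every finite weighted graph -/

section Graph

variable {V : Type*} [Fintype V] [DecidableEq V]

/-- **Generalised face inequalities on every finite weighted graph.**  For reals `p, q ≥ 1` with `p² + pq + q² ≤ pq(p+q)`, bond percolation with
arbitrary pair weights on a finite vertex type and vertices `a, b, c`, with `Q = μ(a|b|c)`, `I_a = μ(a ↮ {b,c})`, `I_b = μ(b ↮ {a,c})`,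
`I_c = μ(c ↮ {a,b})` (so `I_b − Q = μ(ac|b)`, `I_a − Q = μ(bc|a)`, `I_a + I_b − Q = μ(a ≁ b)`, `1 − I_c = μ(c ↔ {a,b})`):

  `(I_a + I_b − Q)·(1 − I_c) ≤ q·(I_b − Q) + p·(I_a − Q)`,  i.e.  `P(a≁b)·P(c↔{a,b}) ≤ q·P(ac|b) + p·P(bc|a)`.

`p = q = 3/2` is the face inequality `(C½)`. [this work] -/
theorem faceAsym_graph {p q : ℝ} (hp : 1 ≤ p) (hq : 1 ≤ q) (hpq : p ^ 2 + p * q + q ^ 2 ≤ p * q * (p + q))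
    (w : Sym2 V → unitInterval) (a b c : V) :
    ((prodBernoulli w).real ((openConn a b)ᶜ ∩ (openConn a c)ᶜ) + (prodBernoulli w).real ((openConn a b)ᶜ ∩ (openConn b c)ᶜ)
        - (prodBernoulli w).real ((openConn a b)ᶜ ∩ (openConn a c)ᶜ ∩ (openConn b c)ᶜ)) *
      (1 - (prodBernoulli w).real ((openConn a c)ᶜ ∩ (openConn b c)ᶜ)) ≤
    q * ((prodBernoulli w).real ((openConn a b)ᶜ ∩ (openConn b c)ᶜ)
          - (prodBernoulli w).real ((openConn a b)ᶜ ∩ (openConn a c)ᶜ ∩ (openConn b c)ᶜ)) +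
      p * ((prodBernoulli w).real ((openConn a b)ᶜ ∩ (openConn a c)ᶜ)
          - (prodBernoulli w).real ((openConn a b)ᶜ ∩ (openConn a c)ᶜ ∩ (openConn b c)ᶜ)) := by
  have hint : ((openConn a b)ᶜ ∩ (openConn a c)ᶜ) ∩ ((openConn a b)ᶜ ∩ (openConn b c)ᶜ) =
      ((openConn a b)ᶜ ∩ (openConn a c)ᶜ ∩ (openConn b c)ᶜ : Set (BondConfig V)) := by
    ext ω; simp only [mem_inter_iff]; tauto
  set μ := prodBernoulli w with hμ
  set Sep : Set (BondConfig V) := (openConn a b)ᶜ ∩ (openConn a c)ᶜ ∩ (openConn b c)ᶜ with hSep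
  set IA : Set (BondConfig V) := (openConn a b)ᶜ ∩ (openConn a c)ᶜ with hIA
  set IB : Set (BondConfig V) := (openConn a b)ᶜ ∩ (openConn b c)ᶜ with hIB
  set IC : Set (BondConfig V) := (openConn a c)ᶜ ∩ (openConn b c)ᶜ with hIC
  have hQA : μ.real Sep ≤ μ.real IA := measureReal_mono (fun ω hω => hω.1)
  have hQB : μ.real Sep ≤ μ.real IB := measureReal_mono (fun ω hω => ⟨hω.1.1, hω.2⟩)
  have hQC : μ.real Sep ≤ μ.real IC := measureReal_mono (fun ω hω => ⟨hω.1.2, hω.2⟩)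
  have hN1 : μ.real IA + μ.real IB - μ.real Sep ≤ 1 := by
    have hu := measureReal_union_add_inter (μ := μ) (s := IA) (t := IB) MeasurableSet.of_discrete
    rw [hint] at hu
    linarith [(measureReal_le_one : μ.real (IA ∪ IB) ≤ 1)]
  exact face_of_law hp hq hpq measureReal_nonneg hQA hQB hQC measureReal_le_one hN1 (isoAsymPort_all hp hq hpq w a b c)

/-- **CONJECTURE AF¹ is a theorem (both pendant quadratics, `λ = 3/2`).**  For every finite weighted graph, port `c`, terminals `a, b`, and every
`γ ≥ 0`, with `t = μ(ac|b)`, `u = μ(bc|a)`, `N₀ = μ(a≁b)`, `k = μ(c↔{a,b})` written in isolation coordinates as in `faceAsym_graph`: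
`0 ≤ (¾t + ¼u) + γ[(3/2)t + u − (3/2)N₀k] + γ²u` and `0 ≤ (¾u + ¼t) + γ[(3/2)u + t − (3/2)N₀k] + γ²t`
(the `AFone[3/2; γ; N₀, t, u, k]` pair of `…SuperTerminalP3LamAFreePendant`).  Member `σ = 3/(1+2γ)` of `faceAsym_graph`, i.e.
`p = (4γ²+10γ+13)/(6(2+γ))`, `q = (4γ²+10γ+13)/(2(1+2γ)(2+γ))` (and swapped). [this work] -/
theorem afOne_graph (w : Sym2 V → unitInterval) (a b c : V) {g : ℝ} (hg : 0 ≤ g) :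
    (0 ≤ (3 / 2 - 1) * ((3 / 2 - 1) * (((prodBernoulli w).real ((openConn a b)ᶜ ∩ (openConn b c)ᶜ)
            - (prodBernoulli w).real ((openConn a b)ᶜ ∩ (openConn a c)ᶜ ∩ (openConn b c)ᶜ)) +
          ((prodBernoulli w).real ((openConn a b)ᶜ ∩ (openConn a c)ᶜ)
            - (prodBernoulli w).real ((openConn a b)ᶜ ∩ (openConn a c)ᶜ ∩ (openConn b c)ᶜ))) +
          ((prodBernoulli w).real ((openConn a b)ᶜ ∩ (openConn b c)ᶜ)
            - (prodBernoulli w).real ((openConn a b)ᶜ ∩ (openConn a c)ᶜ ∩ (openConn b c)ᶜ))) +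
        g * (2 * (3 / 2 - 1) * (((prodBernoulli w).real ((openConn a b)ᶜ ∩ (openConn b c)ᶜ)
            - (prodBernoulli w).real ((openConn a b)ᶜ ∩ (openConn a c)ᶜ ∩ (openConn b c)ᶜ)) +
          ((prodBernoulli w).real ((openConn a b)ᶜ ∩ (openConn a c)ᶜ)
            - (prodBernoulli w).real ((openConn a b)ᶜ ∩ (openConn a c)ᶜ ∩ (openConn b c)ᶜ))) +
          (1 - (3 / 2 - 1)) * ((prodBernoulli w).real ((openConn a b)ᶜ ∩ (openConn b c)ᶜ)
            - (prodBernoulli w).real ((openConn a b)ᶜ ∩ (openConn a c)ᶜ ∩ (openConn b c)ᶜ)) -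
          3 / 2 * ((prodBernoulli w).real ((openConn a b)ᶜ ∩ (openConn a c)ᶜ) + (prodBernoulli w).real ((openConn a b)ᶜ ∩ (openConn b c)ᶜ)
            - (prodBernoulli w).real ((openConn a b)ᶜ ∩ (openConn a c)ᶜ ∩ (openConn b c)ᶜ)) *
            (1 - (prodBernoulli w).real ((openConn a c)ᶜ ∩ (openConn b c)ᶜ))) +
        g ^ 2 * ((prodBernoulli w).real ((openConn a b)ᶜ ∩ (openConn a c)ᶜ)
            - (prodBernoulli w).real ((openConn a b)ᶜ ∩ (openConn a c)ᶜ ∩ (openConn b c)ᶜ))) ∧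
    (0 ≤ (3 / 2 - 1) * ((3 / 2 - 1) * (((prodBernoulli w).real ((openConn a b)ᶜ ∩ (openConn b c)ᶜ)
            - (prodBernoulli w).real ((openConn a b)ᶜ ∩ (openConn a c)ᶜ ∩ (openConn b c)ᶜ)) +
          ((prodBernoulli w).real ((openConn a b)ᶜ ∩ (openConn a c)ᶜ)
            - (prodBernoulli w).real ((openConn a b)ᶜ ∩ (openConn a c)ᶜ ∩ (openConn b c)ᶜ))) +
          ((prodBernoulli w).real ((openConn a b)ᶜ ∩ (openConn a c)ᶜ)
            - (prodBernoulli w).real ((openConn a b)ᶜ ∩ (openConn a c)ᶜ ∩ (openConn b c)ᶜ))) +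
        g * (2 * (3 / 2 - 1) * (((prodBernoulli w).real ((openConn a b)ᶜ ∩ (openConn b c)ᶜ)
            - (prodBernoulli w).real ((openConn a b)ᶜ ∩ (openConn a c)ᶜ ∩ (openConn b c)ᶜ)) +
          ((prodBernoulli w).real ((openConn a b)ᶜ ∩ (openConn a c)ᶜ)
            - (prodBernoulli w).real ((openConn a b)ᶜ ∩ (openConn a c)ᶜ ∩ (openConn b c)ᶜ))) +
          (1 - (3 / 2 - 1)) * ((prodBernoulli w).real ((openConn a b)ᶜ ∩ (openConn a c)ᶜ)
            - (prodBernoulli w).real ((openConn a b)ᶜ ∩ (openConn a c)ᶜ ∩ (openConn b c)ᶜ)) -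
          3 / 2 * ((prodBernoulli w).real ((openConn a b)ᶜ ∩ (openConn a c)ᶜ) + (prodBernoulli w).real ((openConn a b)ᶜ ∩ (openConn b c)ᶜ)
            - (prodBernoulli w).real ((openConn a b)ᶜ ∩ (openConn a c)ᶜ ∩ (openConn b c)ᶜ)) *
            (1 - (prodBernoulli w).real ((openConn a c)ᶜ ∩ (openConn b c)ᶜ))) +
        g ^ 2 * ((prodBernoulli w).real ((openConn a b)ᶜ ∩ (openConn b c)ᶜ)
            - (prodBernoulli w).real ((openConn a b)ᶜ ∩ (openConn a c)ᶜ ∩ (openConn b c)ᶜ))) := by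
  set μ := prodBernoulli w with hμ
  set Q := μ.real ((openConn a b)ᶜ ∩ (openConn a c)ᶜ ∩ (openConn b c)ᶜ) with hQ
  set IA := μ.real ((openConn a b)ᶜ ∩ (openConn a c)ᶜ) with hIA
  set IB := μ.real ((openConn a b)ᶜ ∩ (openConn b c)ᶜ) with hIB
  set IC := μ.real ((openConn a c)ᶜ ∩ (openConn b c)ᶜ) with hIC
  have hQA : Q ≤ IA := measureReal_mono (fun ω hω => hω.1)
  have hQB : Q ≤ IB := measureReal_mono (fun ω hω => ⟨hω.1.1, hω.2⟩)
  -- the admissible pair of exponents for `σ = 3/(1+2γ)`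
  set A : ℝ := 4 * g ^ 2 + 10 * g + 13 with hA
  set M : ℝ := 6 * (2 + g) * (1 + 2 * g) with hM
  clear_value A M
  have hMpos : 0 < M := by rw [hM]; positivity
  have hApos : 0 < A := by rw [hA]; positivity
  have adm : ∀ {P' Q' : ℝ}, M ≤ P' → M ≤ Q' → P' * Q' * (P' + Q') = M * (P' ^ 2 + P' * Q' + Q' ^ 2) →
      1 ≤ P' / M ∧ 1 ≤ Q' / M ∧ (P' / M) ^ 2 + P' / M * (Q' / M) + (Q' / M) ^ 2 ≤ P' / M * (Q' / M) * (P' / M + Q' / M) := by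
    intro P' Q' hP hQ' hcurve
    refine ⟨(one_le_div hMpos).2 hP, (one_le_div hMpos).2 hQ', ?_⟩
    have hM0 : M ≠ 0 := hMpos.ne'
    have key : P' / M * (Q' / M) * (P' / M + Q' / M) - ((P' / M) ^ 2 + P' / M * (Q' / M) + (Q' / M) ^ 2) =
        (P' * Q' * (P' + Q') - M * (P' ^ 2 + P' * Q' + Q' ^ 2)) / M ^ 3 := by
      field_simp
    rw [hcurve, sub_self, zero_div] at key
    linarith
  have hP1 : M ≤ A * (1 + 2 * g) := by rw [hM, hA]; nlinarith [sq_nonneg (2 * g + 1)]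
  have hQ1 : M ≤ 3 * A := by rw [hM, hA]; nlinarith
  have hcurve : A * (1 + 2 * g) * (3 * A) * (A * (1 + 2 * g) + 3 * A) = M * ((A * (1 + 2 * g)) ^ 2 + A * (1 + 2 * g) * (3 * A) + (3 * A) ^ 2) := by
    rw [hM, hA]; ring
  have hcurve' : 3 * A * (A * (1 + 2 * g)) * (3 * A + A * (1 + 2 * g)) = M * ((3 * A) ^ 2 + 3 * A * (A * (1 + 2 * g)) + (A * (1 + 2 * g)) ^ 2) := by
    rw [hM, hA]; ring
  -- the two face inequalities (`p` on `I_a`, `q` on `I_b`), cleared of denominators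
  obtain ⟨hp, hq, hpq⟩ := adm hP1 hQ1 hcurve
  obtain ⟨hp', hq', hpq'⟩ := adm hQ1 hP1 hcurve'
  have F1 := faceAsym_graph hp hq hpq w a b c
  have F2 := faceAsym_graph hp' hq' hpq' w a b c
  rw [← hμ] at F1 F2
  change (IA + IB - Q) * (1 - IC) ≤ 3 * A / M * (IB - Q) + A * (1 + 2 * g) / M * (IA - Q) at F1
  change (IA + IB - Q) * (1 - IC) ≤ A * (1 + 2 * g) / M * (IB - Q) + 3 * A / M * (IA - Q) at F2
  have hM0 : M ≠ 0 := hMpos.ne'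
  have D1 : M * ((IA + IB - Q) * (1 - IC)) ≤ 3 * A * (IB - Q) + A * (1 + 2 * g) * (IA - Q) := by
    have h := mul_le_mul_of_nonneg_left F1 hMpos.le
    have e : M * (3 * A / M * (IB - Q) + A * (1 + 2 * g) / M * (IA - Q)) = 3 * A * (IB - Q) + A * (1 + 2 * g) * (IA - Q) := by
      field_simp
    rwa [e] at h
  have D2 : M * ((IA + IB - Q) * (1 - IC)) ≤ A * (1 + 2 * g) * (IB - Q) + 3 * A * (IA - Q) := by
    have h := mul_le_mul_of_nonneg_left F2 hMpos.le
    have e : M * (A * (1 + 2 * g) / M * (IB - Q) + 3 * A / M * (IA - Q)) = A * (1 + 2 * g) * (IB - Q) + 3 * A * (IA - Q) := by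
      field_simp
    rwa [e] at h
  have ht0 : 0 ≤ IB - Q := sub_nonneg.2 hQB
  have hu0 : 0 ≤ IA - Q := sub_nonneg.2 hQA
  have hsq : 0 ≤ (1 - g) ^ 2 := sq_nonneg _
  -- `4(2+γ)(1+2γ)·AF¹_τ = 6(1−γ)²·t + 2(1−γ)²(1+2γ)·u + γ·D̃₁` and the mirror
  constructor
  · have key : 4 * (2 + g) * (1 + 2 * g) * ((3 / 2 - 1) * ((3 / 2 - 1) * ((IB - Q) + (IA - Q)) + (IB - Q)) +
        g * (2 * (3 / 2 - 1) * ((IB - Q) + (IA - Q)) + (1 - (3 / 2 - 1)) * (IB - Q) - 3 / 2 * (IA + IB - Q) * (1 - IC)) +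
        g ^ 2 * (IA - Q)) =
        6 * (1 - g) ^ 2 * (IB - Q) + 2 * (1 - g) ^ 2 * (1 + 2 * g) * (IA - Q) +
          g * (3 * A * (IB - Q) + A * (1 + 2 * g) * (IA - Q) - M * ((IA + IB - Q) * (1 - IC))) := by
      rw [hA, hM]; ring
    have hpos : 0 < 4 * (2 + g) * (1 + 2 * g) := by positivity
    have rhs : 0 ≤ 6 * (1 - g) ^ 2 * (IB - Q) + 2 * (1 - g) ^ 2 * (1 + 2 * g) * (IA - Q) +
        g * (3 * A * (IB - Q) + A * (1 + 2 * g) * (IA - Q) - M * ((IA + IB - Q) * (1 - IC))) := by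
      have h1 : 0 ≤ 6 * (1 - g) ^ 2 * (IB - Q) := by positivity
      have h2 : 0 ≤ 2 * (1 - g) ^ 2 * (1 + 2 * g) * (IA - Q) := by positivity
      have h3 : 0 ≤ g * (3 * A * (IB - Q) + A * (1 + 2 * g) * (IA - Q) - M * ((IA + IB - Q) * (1 - IC))) :=
        mul_nonneg hg (by linarith)
      linarith
    rw [← key] at rhs
    exact (mul_nonneg_iff_of_pos_left hpos).1 rhs
  · have key : 4 * (2 + g) * (1 + 2 * g) * ((3 / 2 - 1) * ((3 / 2 - 1) * ((IB - Q) + (IA - Q)) + (IA - Q)) +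
        g * (2 * (3 / 2 - 1) * ((IB - Q) + (IA - Q)) + (1 - (3 / 2 - 1)) * (IA - Q) - 3 / 2 * (IA + IB - Q) * (1 - IC)) +
        g ^ 2 * (IB - Q)) =
        6 * (1 - g) ^ 2 * (IA - Q) + 2 * (1 - g) ^ 2 * (1 + 2 * g) * (IB - Q) +
          g * (A * (1 + 2 * g) * (IB - Q) + 3 * A * (IA - Q) - M * ((IA + IB - Q) * (1 - IC))) := by
      rw [hA, hM]; ring
    have hpos : 0 < 4 * (2 + g) * (1 + 2 * g) := by positivity
    have rhs : 0 ≤ 6 * (1 - g) ^ 2 * (IA - Q) + 2 * (1 - g) ^ 2 * (1 + 2 * g) * (IB - Q) +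
        g * (A * (1 + 2 * g) * (IB - Q) + 3 * A * (IA - Q) - M * ((IA + IB - Q) * (1 - IC))) := by
      have h1 : 0 ≤ 6 * (1 - g) ^ 2 * (IA - Q) := by positivity
      have h2 : 0 ≤ 2 * (1 - g) ^ 2 * (1 + 2 * g) * (IB - Q) := by positivity
      have h3 : 0 ≤ g * (A * (1 + 2 * g) * (IB - Q) + 3 * A * (IA - Q) - M * ((IA + IB - Q) * (1 - IC))) :=
        mul_nonneg hg (by linarith)
      linarith
    rw [← key] at rhs
    exact (mul_nonneg_iff_of_pos_left hpos).1 rhs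

end Graph

end Summit.CriticalPhenomena.PercolationContinuityZ3.Theorems.ThreePointIsoAsymFace
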